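import Summits.NavierStokesRegularity.NavierStokesRegularity.Theorems.AxisymmetricExtremalityAxisymmetricKatoGlobalStubSeregin2020TypeIILemma22ExpansionOfPositivityV2
import Summits.NavierStokesRegularity.NavierStokesRegularity.Theorems.AxisymmetricExtremalityAxisymmetricKatoGlobalStubSeregin2020TypeIILemma22MoserIteration
import Summits.NavierStokesRegularity.NavierStokesRegularity.Theorems.AxisymmetricExtremalityAxisymmetricKatoGlobalStubSeregin2020TypeIILemma22MoserStep
import Summits.NavierStokesRegularity.NavierStokesRegularity.Theorems.AxisymmetricExtremalityAxisymmetricKatoGlobalStubSeregin2020TypeIILemma22DensityAtom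
import Summits.NavierStokesRegularity.NavierStokesRegularity.Theorems.AxisymmetricExtremalityAxisymmetricKatoGlobalStubSeregin2020TypeIILemma22ShrinkingAtom
import HarnessLib

/-!
# Seregin 2020, Lemma 2.2 (after Nazarov–Uraltseva 2012): the registered target of piece L22-C,
# `lemma22_expansionOfPositivity` (N–U Cor 3.3 «expansion of positivity», energy class)

Helper toward the stub `stub_seregin2020TypeII` of the crux `AxisymmetricKatoGlobal` (Seregin 2020,
Thm 2.1 ⇐ Lemma 2.2 = N–U Lemma 4.2 in class 𝒱). Piece L22-C = the composition
`lemma22_expansionOfPositivity_of_atoms` (landed) applied to the three landed atoms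
`lemma22_smallSublevel_lowerBound`, `lemma22_densityPropagation`, `lemma22_shrinking`.
Registered stub of stmt-NavierStokesRegularity-15453 (v2 text); consumed by the final `hWH′`
assembly (L22-A). No NS statement is proved.

## References

* A. I. Nazarov, N. N. Uraltseva, St. Petersburg Math. J. 23 (2012) = arXiv:1011.1888, Cor 3.3,
  Lemma 4.2. [NazarovUraltseva2012]
* G. Seregin, Anal. Math. Phys. 10 (2020) 46 = arXiv:2006.04140, Lemma 2.2. [Seregin2020]
-/

-- the problem directory repeats the summit name (D-0017); core's `dupNamespace` linter fires
set_option linter.dupNamespace false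

noncomputable section

open MeasureTheory Set Function Filter Topology TopologicalSpace Metric
open scoped NNReal ENNReal

namespace Summit.NavierStokesRegularity.NavierStokesRegularity.Theorems.AxisymmetricKatoGlobal.EulerScaling

open Literature.Analysis.FluidPDE Literature.Analysis.FluidPDE.Seregin2020

/-- **N–U Cor 3.3 «expansion of positivity» in the energy class (piece L22-C of Lemma 2.2,
registered text).** [cite: NazarovUraltseva2012, Cor 3.3 and proof of Lemma 4.2] -/
theorem lemma22_expansionOfPositivity : ∀ (δ : ℝ) (N : ℝ≥0), 0 < δ → ∃ β₃ : ℝ, 0 < β₃ ∧ ∀ (Φ : ℝ → EuclideanSpace ℝ (Fin 3) → ℝ) (U : ℝ → EuclideanSpace ℝ (Fin 3) → EuclideanSpace ℝ (Fin 3)) (S : Set (ℝ × EuclideanSpace ℝ (Fin 3))) (k R : ℝ), (0 < k ∧ 0 < R ∧ Measurable (uncurry Φ) ∧ AEStronglyMeasurable (uncurry U) volume ∧ IsClosed S ∧ (∀ z ∈ S, cylRadius z.2 = 0) ∧ ContinuousOn (uncurry Φ) ({z : ℝ × EuclideanSpace ℝ (Fin 3) | z.1 < 0} \ S) ∧ (∀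 t x, 0 ≤ Φ t x) ∧ (∀ᵐ t : ℝ, t ∈ Ioo (-R ^ 2) 0 → ContDiff ℝ 1 (Φ t)) ∧ (∫⁻ s in Ioo (-R ^ 2) 0, (∫⁻ y in ball (0 : EuclideanSpace ℝ (Fin 3)) (2 * R), ‖U s y‖ₑ ^ (3 : ℕ)) ^ (4 / 3 : ℝ) ≤ (N : ℝ≥0∞) * ENNReal.ofReal R ^ 2) ∧ (∀ (H : ℝ → ℝ), ContDiff ℝ 2 H → (∀ v, deriv H v ≤ 0) → (∀ v, 0 ≤ H v) → (∀ v, 0 ≤ deriv (deriv H) v) → (∀ v, deriv H v ^ 2 ≤ 2 * H v * deriv (deriv H) v) → (∀ v, k ≤ v → H v = 0) → ∀ (Θ : EuclideanSpace ℝ (Fin 3) → ℝ), ContDiff ℝ 1 Θ → HasCompactSupport Θ → tsupport Θ ⊆ ball (0 : EuclideanSpace ℝ (Fin 3)) (2 * R) → ∀ (η : ℝ → ℝ), ContDiff ℝ 1 η → (∀ s, 0 ≤ η s) → ∀ (t₁ t₂ : ℝ), -R ^ 2 < t₁ → t₁ ≤ t₂ → t₂ < 0 → ENNReal.ofReal (η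 t₂ * ∫ x, H (Φ t₂ x) * Θ x ^ 2) + ∫⁻ z in Icc t₁ t₂ ×ˢ (univ : Set (EuclideanSpace ℝ (Fin 3))), ENNReal.ofReal (1 / 2 * η z.1 * (deriv (deriv H) (Φ z.1 z.2) * ‖gradient (Φ z.1) z.2‖ ^ 2 * Θ z.2 ^ 2)) ≤ ENNReal.ofReal (η t₁ * (∫ x, H (Φ t₁ x) * Θ x ^ 2) + (4 * ∫ z in Icc t₁ t₂ ×ˢ (univ : Set (EuclideanSpace ℝ (Fin 3))), η z.1 * (H (Φ z.1 z.2) * ‖gradient Θ z.2‖ ^ 2)) + (∫ z in Icc t₁ t₂ ×ˢ (univ : Set (EuclideanSpace ℝ (Fin 3))), η z.1 * (H (Φ z.1 z.2) * inner ℝ (U z.1 z.2) (gradient (fun y => Θ y ^ 2) z.2))) + (∫ z in Icc t₁ t₂ ×ˢ (univ : Set (EuclideanSpace ℝ (Fin 3))), η z.1 * (2 / cylRadius z.2 * (H (Φ z.1 z.2) * fderiv ℝ (fun y => Θ y ^ 2) z.2 (eR z.2)))) + (∫ z in Icc t₁ t₂ ×ˢ (univ : Set (EuclideanSpace ℝ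 (Fin 3))), |deriv η z.1| * (H (Φ z.1 z.2) * Θ z.2 ^ 2))))) → ∀ (κ : ℝ), 0 < κ → κ ≤ k → ENNReal.ofReal (δ * R ^ 5) ≤ volume {z : ℝ × EuclideanSpace ℝ (Fin 3) | z ∈ Icc (-R ^ 2) (-(3 / 4) * R ^ 2) ×ˢ ball (0 : EuclideanSpace ℝ (Fin 3)) R ∧ κ < Φ z.1 z.2} → ∀ᵐ z ∂(volume.restrict (parabolicCylinder (R / 2) (0 : ℝ × EuclideanSpace ℝ (Fin 3)))), β₃ * κ ≤ Φ z.1 z.2 :=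
  lemma22_expansionOfPositivity_of_atoms
    (lemma22_smallSublevel_lowerBound_of_moserStep lemma22_moserStep) lemma22_densityPropagation
    lemma22_shrinking

end Summit.NavierStokesRegularity.NavierStokesRegularity.Theorems.AxisymmetricKatoGlobal.EulerScaling

end
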